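import Literature.NumberTheory.LFunctions.DirichletLTruncationCertificates
import Literature.NumberTheory.LFunctions.NoRealZeroOddSmallModuliII
import HarnessLib

/-!
# Truncation certificates with drift: `L(σ, χ) > 0` on `[1/2, 1]` for ODD real characters (and even ones),
# truncating after `K` periods — the one-sided second-order tail bound, evaluated in the kernel

Topic `Literature/NumberTheory/LFunctions`; namespace `Literature.NumberTheory.LFunctions.LTruncationCert`
(continues `DirichletLTruncationCertificates.lean`).  Small computable definitions (`sumsNeg`, `certDriftOK`)
and THEOREMS; no named fact, no `sorry`.  Cell `parity-realchar` (kernel floor of the wide column, odd side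
beyond the Epstein-grouping range `576`).

## The method

For an ODD real character the second partial sums `U(N) = ∑_{K ≤ N} S(K)` (`S(K) = ∑_{n ≤ K} χ(n)`) are not
periodic: `U(N + q) = U(N) + U(q)` with the DRIFT `U(q) = −∑_{n ≤ q} n χ(n) = q·h(−q) > 0`.  A non-negative
drift only helps a LOWER bound: with `B⁻ = max_{N ≤ q} max(0, −U(N))` one has `U(N) ≥ −B⁻` for all `N`, and
the second Abel summation of `DirichletLTruncationBound.lean` gives, for `χ ≠ χ₀` with real values,
`U(q) ≥ 0`, real `σ > 0` and any number `K ≥ 1` of periods,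
  `ℜ L(σ, χ) ≥ ∑_{n ≤ Kq} χ(n) n^{−σ} − B⁻ · ((Kq+1)^{−σ} − (Kq+2)^{−σ})`
(`re_LFunction_ge_truncation_drift`; Chua's remainder estimate, Theorem 2.2, is two-sided and for `t + 1 = K`
periods).  The kernel checker **`certDriftOK v q K J P`** is `certOK` of the companion file with the
truncation length `Kq`, the bound `B⁻` and the check `U(q) ≥ 0` in place of `q`, `max |U|`, `U(q) = 0`; its
soundness **`lfunction_ne_zero_of_certDriftOK`** reuses the cell machinery (`loop_getElem?`, `aSpec_le`,
`dSpec_ge`, `rootEnc_spec`, `exists_cell`, `LTruncation.cell_bound`) and the reflection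
`LTruncation.lfunction_ne_zero_of_re_pos`.  Wrappers `good_odd_of_odd/four/eight` (parity test or certificate)
for `interval_cases` range files. [cite: Chua2005RealZeros, Theorem 2.2, §2.2 ALGO 1]

## References

* K. S. Chua, *Real zeros of Dedekind zeta functions of real quadratic fields*, Math. Comp. 74 (2005)
  1457–1470, §2. [Chua2005RealZeros]
* M. Watkins, *Real zeros of real odd Dirichlet L-functions*, Math. Comp. 73 (2004) 415–423 (the printed
  odd range `3·10⁸`, by a different method). [Watkins2004RealZeros]
* H. L. Montgomery, R. C. Vaughan, *Multiplicative Number Theory I*, CUP 2007, §1.3, §4.3, §10.1.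
  [MontgomeryVaughan2007]
-/

noncomputable section

namespace Literature.NumberTheory.LFunctions

namespace LTruncationCert

open Finset Complex Filter Topology FeketePolyaKernel PrimitiveQuadratic LTruncation DirichletAbel

/-! ### One-sided Abel inequality and the tail with drift -/

/-- **One-sided Abel inequality.** If the partial sums `∑_{k<N} a_k ≥ −B` (`N ≤ L`) and the weights
`w_k ≥ 0` decrease, then `∑_{k<L} a_k w_k ≥ −B w_0`. [cite: MontgomeryVaughan2007, §1.3 Thm. 1.3] -/
theorem sum_mul_ge_of_antitone (a : ℕ → ℝ) (w : ℕ → ℝ) {B : ℝ} (L : ℕ)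
    (hA : ∀ N, N ≤ L → -B ≤ ∑ k ∈ range N, a k) (hw0 : ∀ k, 0 ≤ w k)
    (hw : ∀ k, w (k + 1) ≤ w k) :
    -(B * w 0) ≤ ∑ k ∈ range L, a k * w k := by
  have hB : 0 ≤ B := by have := hA 0 (Nat.zero_le L); simp at this; linarith
  rcases Nat.eq_zero_or_pos L with rfl | hL
  · simp; exact mul_nonneg hB (hw0 0)
  have hparts := Finset.sum_range_by_parts w a L
  have hcomm : ∑ k ∈ range L, a k * w k = ∑ k ∈ range L, w k • a k :=
    Finset.sum_congr rfl fun k _ ↦ by rw [smul_eq_mul, mul_comm]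
  rw [hcomm, hparts]
  have htel : ∑ i ∈ range (L - 1), (w i - w (i + 1)) = w 0 - w (L - 1) :=
    Finset.sum_range_sub' w (L - 1)
  have h1 : -(B * w (L - 1)) ≤ w (L - 1) • ∑ k ∈ range L, a k := by
    rw [smul_eq_mul]; nlinarith [hA L le_rfl, hw0 (L - 1)]
  have h2 : ∑ i ∈ range (L - 1), (w (i + 1) - w i) • ∑ k ∈ range (i + 1), a k ≤
      ∑ i ∈ range (L - 1), (w i - w (i + 1)) * B := by
    refine Finset.sum_le_sum fun i hi ↦ ?_
    have hiL : i + 1 ≤ L := by have := Finset.mem_range.mp hi; omega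
    rw [smul_eq_mul]
    nlinarith [hA (i + 1) hiL, hw i]
  rw [← Finset.sum_mul, htel] at h2
  nlinarith [hw0 (L - 1), hw0 0]

variable {q : ℕ} [NeZero q] (χ : DirichletCharacter ℂ q)

/-- `S(N + Kq) = S(N)` (`χ ≠ χ₀`). [cite: MontgomeryVaughan2007, §4.3 eq. (4.23)] -/
private theorem partialSum_add_mul_level (hχ : χ ≠ 1) (K N : ℕ) :
    partialSum χ (N + K * q) = partialSum χ N := by
  induction K with
  | zero => simp
  | succ K ih => rw [show N + (K + 1) * q = (N + K * q) + q by ring, partialSum_add_level χ hχ, ih]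

omit [NeZero q] in
/-- The Abel terms at a real point (private copy of the companion file's lemma). [cite: MontgomeryVaughan2007, §1.3 Thm. 1.3] -/
private theorem term_ofReal' (n : ℕ) (σ : ℝ) :
    term χ n (σ : ℂ) = partialSum χ (n + 1) *
      ((((n + 1 : ℕ) : ℝ) ^ (-σ) - ((n + 1 + 1 : ℕ) : ℝ) ^ (-σ) : ℝ) : ℂ) := by
  simp only [term]
  rw [show ((n + 1 : ℕ) : ℂ) = (((n + 1 : ℕ) : ℝ) : ℂ) by push_cast; rfl,
    show ((n + 1 + 1 : ℕ) : ℂ) = (((n + 1 + 1 : ℕ) : ℝ) : ℂ) by push_cast; rfl,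
    show -(σ : ℂ) = ((-σ : ℝ) : ℂ) by push_cast; rfl,
    ← Complex.ofReal_cpow (by positivity), ← Complex.ofReal_cpow (by positivity), ← Complex.ofReal_sub]

/-- With a non-negative drift `ℜU(q) ≥ 0`, a lower bound `ℜU(N) ≥ −B` over one period holds everywhere.
[cite: Chua2005RealZeros, Theorem 2.2] -/
theorem re_sum_partialSum_ge (hχ : χ ≠ 1) (hUq : 0 ≤ (∑ k ∈ range q, partialSum χ (k + 1)).re)
    {B : ℝ} (hU : ∀ N, N < q → -B ≤ (∑ k ∈ range N, partialSum χ (k + 1)).re) (N : ℕ) :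
    -B ≤ (∑ k ∈ range N, partialSum χ (k + 1)).re := by
  induction N using Nat.strong_induction_on with
  | _ N ih =>
    rcases lt_or_ge N q with hN | hN
    · exact hU N hN
    · obtain ⟨k, rfl⟩ := Nat.exists_eq_add_of_le hN
      have hsplit : ∑ i ∈ range (q + k), partialSum χ (i + 1) =
          ∑ i ∈ range q, partialSum χ (i + 1) + ∑ i ∈ range k, partialSum χ (i + 1) := by
        rw [Finset.sum_range_add]
        congr 1
        refine Finset.sum_congr rfl fun i _ ↦ ?_
        rw [show q + i + 1 = (i + 1) + q by ring, partialSum_add_level χ hχ]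
      rw [hsplit, Complex.add_re]
      have := ih k (by have := NeZero.pos q; omega)
      linarith

/-- **The tail with drift, `K` periods.** For `χ ≠ χ₀`, `ℜU(q) ≥ 0`, `ℜU(N) ≥ −B` (`N < q`),
real `σ > 0` and `K`: `ℜ ∑_{n > Kq} S(n)(n^{−σ} − (n+1)^{−σ}) ≥ −B((Kq+1)^{−σ} − (Kq+2)^{−σ})`.
[cite: Chua2005RealZeros, Theorem 2.2] -/
theorem re_tsum_term_tail_ge (hχ : χ ≠ 1)
    (hUq : 0 ≤ (∑ k ∈ range q, partialSum χ (k + 1)).re)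
    {B : ℝ} (hU : ∀ N, N < q → -B ≤ (∑ k ∈ range N, partialSum χ (k + 1)).re) {σ : ℝ} (hσ : 0 < σ)
    (K : ℕ) :
    -(B * (((K * q + 1 : ℕ) : ℝ) ^ (-σ) - ((K * q + 1 + 1 : ℕ) : ℝ) ^ (-σ))) ≤
      (∑' k : ℕ, term χ (k + K * q) (σ : ℂ)).re := by
  have hs : 0 < (σ : ℂ).re := by simpa using hσ
  have hsum : Summable fun k : ℕ ↦ term χ (k + K * q) (σ : ℂ) :=
    (summable_nat_add_iff (K * q)).mpr (summable_term χ hχ hs)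
  have ht := (Complex.continuous_re.tendsto _).comp hsum.tendsto_sum_tsum_nat
  refine ge_of_tendsto' ht fun L ↦ ?_
  simp only [Function.comp_apply, Complex.re_sum]
  have hterm : ∀ k, (term χ (k + K * q) (σ : ℂ)).re = (partialSum χ (k + 1)).re *
      (((k + K * q + 1 : ℕ) : ℝ) ^ (-σ) - ((k + K * q + 1 + 1 : ℕ) : ℝ) ^ (-σ)) := fun k ↦ by
    rw [term_ofReal', show k + K * q + 1 = (k + 1) + K * q by ring, partialSum_add_mul_level χ hχ,
      Complex.re_mul_ofReal]
  simp only [hterm]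
  have hA : ∀ N, N ≤ L → -B ≤ ∑ k ∈ range N, (partialSum χ (k + 1)).re := fun N _ ↦ by
    rw [← Complex.re_sum]; exact re_sum_partialSum_ge χ hχ hUq hU N
  have h := sum_mul_ge_of_antitone (fun k ↦ (partialSum χ (k + 1)).re)
    (fun k ↦ ((k + K * q + 1 : ℕ) : ℝ) ^ (-σ) - ((k + K * q + 1 + 1 : ℕ) : ℝ) ^ (-σ))
    (B := B) L hA
    (fun k ↦ by
      have : ((k + K * q + 1 + 1 : ℕ) : ℝ) ^ (-σ) ≤ ((k + K * q + 1 : ℕ) : ℝ) ^ (-σ) :=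
        Real.rpow_le_rpow_of_nonpos (by positivity) (by push_cast; linarith) (by linarith)
      linarith)
    (fun k ↦ by
      have h2 := Literature.Barriers.RiemannHypothesis.two_mul_rpow_neg_lt (k + K * q) hσ
      simp only [show k + 1 + K * q + 1 = k + K * q + 1 + 1 by ring]
      linarith)
  simpa using h

/-- **The truncation bound with drift.** For `χ ≠ χ₀` mod `q`, `ℜU(q) ≥ 0`, `ℜU(N) ≥ −B`
(`N < q`), real `σ > 0` and `K` periods:
`ℜ L(σ, χ) ≥ ∑_{n ≤ Kq} ℜχ(n) n^{−σ} − B((Kq+1)^{−σ} − (Kq+2)^{−σ})`. [cite: Chua2005RealZeros, Theorem 2.2] -/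
theorem re_LFunction_ge_truncation_drift (hχ : χ ≠ 1)
    (hUq : 0 ≤ (∑ k ∈ range q, partialSum χ (k + 1)).re)
    {B : ℝ} (hU : ∀ N, N < q → -B ≤ (∑ k ∈ range N, partialSum χ (k + 1)).re) {σ : ℝ} (hσ : 0 < σ)
    (K : ℕ) :
    (∑ n ∈ range (K * q), (χ ((n + 1 : ℕ) : ZMod q)).re * ((n + 1 : ℕ) : ℝ) ^ (-σ)) -
        B * (((K * q + 1 : ℕ) : ℝ) ^ (-σ) - ((K * q + 1 + 1 : ℕ) : ℝ) ^ (-σ)) ≤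
      (χ.LFunction (σ : ℂ)).re := by
  have hs : 0 < (σ : ℂ).re := by simpa using hσ
  have hsum := summable_term χ hχ hs
  rw [LFunction_eq_abelSum χ hχ hs, abelSum, ← hsum.sum_add_tsum_nat_add (K * q), Complex.add_re]
  -- head
  have hhead : (∑ n ∈ range (K * q), term χ n (σ : ℂ)).re =
      ∑ n ∈ range (K * q), (χ ((n + 1 : ℕ) : ZMod q)).re * ((n + 1 : ℕ) : ℝ) ^ (-σ) := by
    have h := sum_apply_mul_cpow_eq χ (σ : ℂ) (K * q)
    have hq : partialSum χ (K * q) = 0 := by simpa using partialSum_add_mul_level χ hχ K 0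
    rw [hq, zero_mul, zero_add] at h
    rw [← h, Complex.re_sum]
    refine Finset.sum_congr rfl fun n _ ↦ ?_
    rw [show ((n + 1 : ℕ) : ℂ) = (((n + 1 : ℕ) : ℝ) : ℂ) by push_cast; rfl,
      show -(σ : ℂ) = ((-σ : ℝ) : ℂ) by push_cast; rfl, ← Complex.ofReal_cpow (by positivity),
      Complex.re_mul_ofReal]
  rw [hhead]
  have htail := re_tsum_term_tail_ge χ hχ hUq hU hσ K
  linarith

/-- Tail weight at `σ ≥ 1/2` (private copy of the companion file's lemma): for `m ≥ 8`, `σ ≥ 1/2`, `0 < r`,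
`r² ≤ m`: `m^{−σ} − (m+1)^{−σ} ≤ 1/(2rm)`. [cite: Chua2005RealZeros, Theorem 2.2] -/
private theorem wt_le_of_half_le' {σ : ℝ} (hσ : 1 / 2 ≤ σ) {m : ℕ} (hm : 8 ≤ m) {r : ℕ} (hr : 0 < r)
    (hrm : r * r ≤ m) : (m : ℝ) ^ (-σ) - ((m + 1 : ℕ) : ℝ) ^ (-σ) ≤ 1 / (2 * r * m) := by
  have hm0 : (0 : ℝ) < m := by exact_mod_cast (show 0 < m by omega)
  have hr0 : (0 : ℝ) < r := by exact_mod_cast hr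
  have hm1 : (0 : ℝ) < (m : ℝ) + 1 := by linarith
  have hcast : ((m + 1 : ℕ) : ℝ) = (m : ℝ) + 1 := by push_cast; ring
  -- step 1: `m^{-σ} − (m+1)^{-σ} ≤ m^{-σ} σ/m`
  have h1 : (m : ℝ) ^ (-σ) - ((m + 1 : ℕ) : ℝ) ^ (-σ) ≤ (m : ℝ) ^ (-σ) * (σ / m) := by
    rw [hcast]
    have hsplit : ((m : ℝ) + 1) ^ (-σ) = (m : ℝ) ^ (-σ) * (((m : ℝ) + 1) / m) ^ (-σ) := by
      rw [Real.div_rpow hm1.le hm0.le, mul_div_assoc', mul_comm, ← mul_div_assoc', div_self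
        (Real.rpow_pos_of_pos hm0 _).ne', mul_one]
    have hlog : Real.log (((m : ℝ) + 1) / m) ≤ 1 / m := by
      have h := Real.log_le_sub_one_of_pos (show (0 : ℝ) < ((m : ℝ) + 1) / m by positivity)
      have h2 : ((m : ℝ) + 1) / m - 1 = 1 / m := by field_simp; ring
      linarith
    have hexp : 1 - σ / m ≤ (((m : ℝ) + 1) / m) ^ (-σ) := by
      rw [Real.rpow_def_of_pos (by positivity)]
      have h3 := Real.add_one_le_exp (Real.log (((m : ℝ) + 1) / m) * -σ)
      have h4 : Real.log (((m : ℝ) + 1) / m) * σ ≤ 1 / m * σ :=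
        mul_le_mul_of_nonneg_right hlog (by linarith)
      have h5 : 1 / (m : ℝ) * σ = σ / m := by ring
      linarith
    have hpos : 0 < (m : ℝ) ^ (-σ) := Real.rpow_pos_of_pos hm0 _
    rw [hsplit]
    nlinarith [mul_le_mul_of_nonneg_left hexp hpos.le]
  -- step 2: `σ m^{-σ} ≤ (1/2) m^{-1/2}` since `log m ≥ 2`
  have hlog : 2 ≤ Real.log m := by
    have h8 : (8 : ℝ) ≤ m := by exact_mod_cast hm
    have he : Real.exp 2 ≤ 8 := by
      have := Real.exp_one_lt_d9
      have h2 : Real.exp 2 = Real.exp 1 * Real.exp 1 := by rw [← Real.exp_add]; norm_num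
      nlinarith [Real.exp_pos 1]
    calc (2 : ℝ) = Real.log (Real.exp 2) := (Real.log_exp 2).symm
      _ ≤ Real.log m := Real.log_le_log (Real.exp_pos 2) (he.trans h8)
  have h2 : σ * (m : ℝ) ^ (-σ) ≤ 1 / 2 * (m : ℝ) ^ (-(1 / 2 : ℝ)) := by
    have hsplit : (m : ℝ) ^ (-σ) = (m : ℝ) ^ (-(1 / 2 : ℝ)) * Real.exp (-(σ - 1 / 2) * Real.log m) := by
      rw [Real.rpow_def_of_pos hm0, Real.rpow_def_of_pos hm0, ← Real.exp_add]
      congr 1; ring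
    have hexp : Real.exp (-(σ - 1 / 2) * Real.log m) ≤ Real.exp (-(σ - 1 / 2) * 2) := by
      rw [Real.exp_le_exp]; nlinarith
    have hkey : σ * Real.exp (-(σ - 1 / 2) * 2) ≤ 1 / 2 := by
      have h3 := Real.add_one_le_exp (2 * σ - 1)
      have h4 : Real.exp (-(σ - 1 / 2) * 2) * Real.exp (2 * σ - 1) = 1 := by
        rw [← Real.exp_add]; norm_num; ring_nf
      have h5 : 0 < Real.exp (-(σ - 1 / 2) * 2) := Real.exp_pos _
      nlinarith
    have hpos : 0 < (m : ℝ) ^ (-(1 / 2 : ℝ)) := Real.rpow_pos_of_pos hm0 _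
    rw [hsplit]
    have hσ0 : 0 ≤ σ := by linarith
    calc σ * ((m : ℝ) ^ (-(1 / 2 : ℝ)) * Real.exp (-(σ - 1 / 2) * Real.log m))
        = (m : ℝ) ^ (-(1 / 2 : ℝ)) * (σ * Real.exp (-(σ - 1 / 2) * Real.log m)) := by ring
      _ ≤ (m : ℝ) ^ (-(1 / 2 : ℝ)) * (σ * Real.exp (-(σ - 1 / 2) * 2)) :=
          mul_le_mul_of_nonneg_left (mul_le_mul_of_nonneg_left hexp hσ0) hpos.le
      _ ≤ (m : ℝ) ^ (-(1 / 2 : ℝ)) * (1 / 2) := mul_le_mul_of_nonneg_left hkey hpos.le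
      _ = 1 / 2 * (m : ℝ) ^ (-(1 / 2 : ℝ)) := by ring
  have h3 : (m : ℝ) ^ (-(1 / 2 : ℝ)) ≤ 1 / r := by
    have hsq : (r : ℝ) ≤ Real.sqrt m := by
      rw [Real.le_sqrt hr0.le hm0.le]; exact_mod_cast (by simpa [pow_two] using hrm)
    rw [Real.rpow_neg hm0.le, ← Real.sqrt_eq_rpow, one_div]
    exact inv_anti₀ hr0 hsq
  calc (m : ℝ) ^ (-σ) - ((m + 1 : ℕ) : ℝ) ^ (-σ) ≤ (m : ℝ) ^ (-σ) * (σ / m) := h1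
    _ = σ * (m : ℝ) ^ (-σ) / m := by ring
    _ ≤ 1 / 2 * (m : ℝ) ^ (-(1 / 2 : ℝ)) / m := div_le_div_of_nonneg_right h2 hm0.le
    _ ≤ 1 / 2 * (1 / r) / m :=
        div_le_div_of_nonneg_right (mul_le_mul_of_nonneg_left h3 (by norm_num)) hm0.le
    _ = 1 / (2 * r * m) := by field_simp

/-- **Assembly with drift.** `χ` primitive mod `q ≥ 7`, `χ ≠ χ₀`, `K ≥ 1` periods;
`ℜU(q) ≥ 0`, `ℜU(N) ≥ −B` (`N < q`); `0 < r`, `r² ≤ Kq + 1`; and `P_K(σ) = ∑_{n ≤ Kq} ℜχ(n)n^{−σ} > B/(2r(Kq+1))`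
on `[1/2, 1]`.  Then `L(σ, χ) ≠ 0` for `σ ∈ (0, 1)`. [cite: Chua2005RealZeros, §2.2 ALGO 1] -/
theorem lfunction_ne_zero_of_truncation_drift (hprim : χ.IsPrimitive) (hχ : χ ≠ 1)
    (hq7 : 7 ≤ q) {K : ℕ} (hK : 1 ≤ K)
    (hUq : 0 ≤ (∑ k ∈ range q, partialSum χ (k + 1)).re)
    {B : ℝ} (hB : 0 ≤ B) (hU : ∀ N, N < q → -B ≤ (∑ k ∈ range N, partialSum χ (k + 1)).re)
    {r : ℕ} (hr : 0 < r) (hrq : r * r ≤ K * q + 1)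
    (hP : ∀ σ : ℝ, 1 / 2 ≤ σ → σ ≤ 1 → B / (2 * r * (K * q + 1 : ℕ)) <
      ∑ n ∈ range (K * q), (χ ((n + 1 : ℕ) : ZMod q)).re * ((n + 1 : ℕ) : ℝ) ^ (-σ)) :
    ∀ σ : ℝ, 0 < σ → σ < 1 → χ.LFunction (σ : ℂ) ≠ 0 := by
  have hKq : 7 ≤ K * q := le_trans hq7 (Nat.le_mul_of_pos_left q hK)
  refine lfunction_ne_zero_of_re_pos χ hprim (by omega) fun σ hσ hσ1 ↦ ?_
  have h1 := re_LFunction_ge_truncation_drift χ hχ hUq hU (σ := σ) (by linarith) K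
  have h2 : ((K * q + 1 : ℕ) : ℝ) ^ (-σ) - ((K * q + 1 + 1 : ℕ) : ℝ) ^ (-σ) ≤
      1 / (2 * r * (K * q + 1 : ℕ)) := wt_le_of_half_le' hσ (by omega) hr hrq
  have h3 : B * (((K * q + 1 : ℕ) : ℝ) ^ (-σ) - ((K * q + 1 + 1 : ℕ) : ℝ) ^ (-σ)) ≤
      B / (2 * r * (K * q + 1 : ℕ)) := by
    calc B * (((K * q + 1 : ℕ) : ℝ) ^ (-σ) - ((K * q + 1 + 1 : ℕ) : ℝ) ^ (-σ))
        ≤ B * (1 / (2 * r * (K * q + 1 : ℕ))) := mul_le_mul_of_nonneg_left h2 hB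
      _ = B / (2 * r * (K * q + 1 : ℕ)) := by ring
  linarith [hP σ hσ hσ1]


end LTruncationCert

end Literature.NumberTheory.LFunctions

end

/-! ## The kernel checker with drift and its soundness -/

namespace Literature.NumberTheory.LFunctions

namespace LTruncationCert

open Finset FeketePolyaKernel PrimitiveQuadratic LTruncation DirichletAbel

/-- First and second running sums `S`, `U` of `v` over `n = t+1, …, t+fuel` with `max (−U)⁺`. [folklore] -/
def sumsNeg (v : ℕ → ℤ) : ℕ → ℕ → ℤ → ℤ → ℕ → ℤ × ℤ × ℕ
  | 0, _, s, u, B => (s, u, B)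
  | fuel + 1, t, s, u, B =>
    sumsNeg v fuel (t + 1) (s + v (t + 1)) (u + (s + v (t + 1))) (max B (-(u + (s + v (t + 1)))).toNat)

/-- **The certificate with drift.** `certDriftOK v q K J P`: truncation after `K` periods (`N₀ = Kq`), `J` cells
covering `[1/2, 1]`, precision `2^{−P}`; checks `U(q) ≥ 0` and, in every cell,
`2·2J·(N₀+1)·r·a_j·ρ > 2(N₀+1)·r·d_j + 2J·4^P·B⁻` with `a_j ≥ 0`, where `B⁻ = max_{N ≤ q} (−U(N))⁺`,
`ρ ≤ 2^P N₀^{−1/(2J)}`, `r² ≤ N₀ + 1` (cells by `loop` of the companion file). [cite: Chua2005RealZeros, §2.2 ALGO 1] -/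
def certDriftOK (v : ℕ → ℤ) (q K J P : ℕ) : Bool :=
  let N₀ := K * q
  let su := sumsNeg v q 0 0 0 0
  let cells := loop v N₀ J P N₀ 0 (List.replicate J ((0 : ℤ), (0 : ℕ)))
  let ρ := (rootEnc N₀ (2 * J) P).1
  let r := isqrtSucc N₀
  decide (7 ≤ q) && decide (1 ≤ K) && decide (0 < J) && decide (0 ≤ su.2.1) && decide (0 < r) &&
    cells.all (fun c ↦ decide (0 ≤ c.1) &&
      decide (2 * J * (2 ^ P * 2 ^ P) * su.2.2 + 2 * (N₀ + 1) * r * c.2 <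
        2 * (2 * J) * (N₀ + 1) * r * c.1.toNat * ρ))

section Soundness

variable (v : ℕ → ℤ)

/-- Invariant of `sumsNeg`: `S`, `U` and `max (−U)⁺` over one period. [cite: Chua2005RealZeros, Theorem 2.2] -/
theorem sumsNeg_spec : ∀ (fuel t B : ℕ), (∀ j, j ≤ t → (-Uv v j).toNat ≤ B) →
    (sumsNeg v fuel t (Sv v t) (Uv v t) B).1 = Sv v (t + fuel) ∧
      (sumsNeg v fuel t (Sv v t) (Uv v t) B).2.1 = Uv v (t + fuel) ∧
        ∀ j, j ≤ t + fuel → (-Uv v j).toNat ≤ (sumsNeg v fuel t (Sv v t) (Uv v t) B).2.2 := by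
  intro fuel
  induction fuel with
  | zero => intro t B hB; exact ⟨by simp [sumsNeg], by simp [sumsNeg], by simpa [sumsNeg] using hB⟩
  | succ fuel ih =>
    intro t B hB
    have h1 : Sv v t + v (t + 1) = Sv v (t + 1) := by simp [Sv]
    have h2 : Uv v t + (Sv v t + v (t + 1)) = Uv v (t + 1) := by simp [Uv, Sv]
    simp only [sumsNeg]
    rw [h2, h1]
    have hB' : ∀ j, j ≤ t + 1 → (-Uv v j).toNat ≤ max B (-Uv v (t + 1)).toNat := by
      intro j hj
      rcases Nat.lt_or_ge j (t + 1) with hlt | hge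
      · exact (hB j (by omega)).trans (le_max_left _ _)
      · rw [show j = t + 1 by omega]; exact le_max_right _ _
    obtain ⟨e1, e2, e3⟩ := ih (t + 1) _ hB'
    exact ⟨by rw [e1, show t + 1 + fuel = t + (fuel + 1) by ring],
      by rw [e2, show t + 1 + fuel = t + (fuel + 1) by ring],
      fun j hj ↦ e3 j (by omega)⟩

variable {v} {q : ℕ} [NeZero q] {χ : DirichletCharacter ℂ q}

omit [NeZero q] in
/-- A quadratic character with `ℜχ = v` takes the values `v(n) ∈ {0, 1, −1}`. [folklore] -/
private theorem val_trichotomy' (hquad : χ.IsQuadratic) (hv : ∀ n : ℕ, (χ (n : ZMod q)).re = v n)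
    (n : ℕ) : v n = 0 ∨ v n = 1 ∨ v n = -1 := by
  have h := hv n
  rcases hquad (n : ZMod q) with h0 | h1 | h2
  · rw [h0, Complex.zero_re] at h; left; exact_mod_cast h.symm
  · rw [h1, Complex.one_re] at h; right; left; exact_mod_cast h.symm
  · rw [h2, Complex.neg_re, Complex.one_re] at h; right; right; exact_mod_cast h.symm

omit [NeZero q] in
/-- `ℜ S(N) = Sv N`. [folklore] -/
private theorem re_partialSum_eq_Sv (hv : ∀ n : ℕ, (χ (n : ZMod q)).re = v n) :
    ∀ N : ℕ, (partialSum χ N).re = (Sv v N : ℝ) := by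
  intro N
  induction N with
  | zero => simp [Sv]
  | succ N ih => rw [partialSum_succ, Complex.add_re, ih, hv, Sv]; push_cast; ring

omit [NeZero q] in
/-- `ℜ U(N) = Uv N`. [folklore] -/
private theorem re_sum_partialSum_eq_Uv (hv : ∀ n : ℕ, (χ (n : ZMod q)).re = v n) :
    ∀ N : ℕ, (∑ k ∈ range N, partialSum χ (k + 1)).re = (Uv v N : ℝ) := by
  intro N
  induction N with
  | zero => simp [Uv]
  | succ N ih =>
    rw [Finset.sum_range_succ, Complex.add_re, ih, re_partialSum_eq_Sv hv, Uv]; push_cast; ring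

/-- The bisection invariant (private copy). [folklore] -/
private theorem bisect_spec' (pred : ℕ → Bool) : ∀ (fuel xl xh : ℕ), pred xl = true → pred xh = false →
    pred (bisect pred fuel xl xh).1 = true ∧ pred (bisect pred fuel xl xh).2 = false := by
  intro fuel
  induction fuel with
  | zero => intro xl xh h1 h2; exact ⟨h1, h2⟩
  | succ fuel ih =>
    intro xl xh h1 h2
    simp only [bisect]
    split_ifs with hlt hmid
    · exact ih _ _ hmid h2
    · exact ih _ _ h1 (by simpa using hmid)
    · exact ⟨h1, h2⟩

/-- **Soundness of the drift certificate.** For a primitive quadratic `χ` mod `q` with `ℜχ(n) = v(n)`: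
`certDriftOK v q K J P = true ⇒ L(σ, χ) ≠ 0` for every `σ ∈ (0, 1)`. [cite: Chua2005RealZeros, §2.2 ALGO 1] -/
theorem lfunction_ne_zero_of_certDriftOK (hprim : χ.IsPrimitive) (hquad : χ.IsQuadratic)
    (hv : ∀ n : ℕ, (χ (n : ZMod q)).re = v n) {K J P : ℕ} (hcert : certDriftOK v q K J P = true) :
    ∀ σ : ℝ, 0 < σ → σ < 1 → χ.LFunction (σ : ℂ) ≠ 0 := by
  simp only [certDriftOK, Bool.and_eq_true, decide_eq_true_eq, List.all_eq_true] at hcert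
  obtain ⟨⟨⟨⟨⟨hq7, hK⟩, hJ⟩, hU0⟩, hr⟩, hcells⟩ := hcert
  have hJ1 : 1 ≤ J := hJ
  have hv3 := val_trichotomy' hquad hv
  set N₀ : ℕ := K * q with hN₀
  have hN₀7 : 7 ≤ N₀ := le_trans hq7 (Nat.le_mul_of_pos_left q hK)
  -- the running sums
  obtain ⟨-, e2, e3⟩ := sumsNeg_spec v q 0 0 (fun j hj ↦ by rw [show j = 0 by omega]; simp [Uv])
  simp only [Sv, Uv, zero_add] at e2 e3
  set Bn : ℕ := (sumsNeg v q 0 0 0 0).2.2 with hBn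
  rw [e2] at hU0
  have hUq : 0 ≤ (∑ k ∈ range q, partialSum χ (k + 1)).re := by
    rw [re_sum_partialSum_eq_Uv hv]; exact_mod_cast hU0
  have hU : ∀ N, N < q → -(Bn : ℝ) ≤ (∑ k ∈ range N, partialSum χ (k + 1)).re := by
    intro N hN
    rw [re_sum_partialSum_eq_Uv hv]
    have h1 := e3 N hN.le
    have h2 : -Uv v N ≤ ((-Uv v N).toNat : ℤ) := Int.self_le_toNat _
    have h3 : -(Bn : ℤ) ≤ Uv v N := by omega
    exact_mod_cast h3
  -- `r = isqrtSucc N₀`: `r² ≤ N₀ + 1`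
  have hrq : isqrtSucc N₀ * isqrtSucc N₀ ≤ N₀ + 1 := by
    have := (bisect_spec' (fun r ↦ decide (r * r ≤ N₀ + 1)) (N₀ + 2) 0 (N₀ + 2) (by simp)
      (by simp only [decide_eq_false_iff_not, not_le]; nlinarith)).1
    simpa [isqrtSucc] using this
  set r := isqrtSucc N₀ with hrdef
  have hχ1 : χ ≠ 1 := SelbergDirichlet.ne_one_of_isPrimitive (by omega) hprim
  refine lfunction_ne_zero_of_truncation_drift χ hprim hχ1 hq7 hK hUq (Nat.cast_nonneg Bn) hU hr hrq
    fun σ hσ1 hσ2 ↦ ?_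
  -- choose the cell
  obtain ⟨j, hjJ, u, hu0, huh, hσ⟩ := exists_cell hJ1 hσ1 hσ2
  set s₀ : ℝ := ((J + j : ℕ) : ℝ) / ((2 * J : ℕ) : ℝ) with hs₀
  have hinit : ∀ j', j' < J → (List.replicate J ((0 : ℤ), (0 : ℕ)))[j']? =
      some (aSpec v J P j' 0, dSpec v N₀ J P j' 0) := fun j' hj' ↦ by
    rw [List.getElem?_replicate, if_pos hj']; rfl
  have hget := loop_getElem? v N₀ J P N₀ 0 _ hinit j hjJ
  simp only [zero_add] at hget
  obtain ⟨ha0, hineq⟩ := hcells _ (List.mem_of_getElem? hget)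
  simp only at ha0 hineq
  set a : ℤ := aSpec v J P j N₀ with hadef
  set d : ℕ := dSpec v N₀ J P j N₀ with hddef
  set ρ : ℕ := (rootEnc N₀ (2 * J) P).1 with hρdef
  set A : ℝ := ∑ n ∈ range N₀, (v (n + 1) : ℝ) * ((n + 1 : ℕ) : ℝ) ^ (-s₀) with hAdef
  set D : ℝ := ∑ i ∈ range (N₀ - 1), max 0 (-(∑ n ∈ range (i + 1), (v (n + 1) : ℝ) *
      ((n + 1 : ℕ) : ℝ) ^ (-s₀))) / ((i + 1 : ℕ) : ℝ) with hDdef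
  set qu : ℝ := ((N₀ : ℕ) : ℝ) ^ (-u) with hqu
  have hq0 : (0 : ℝ) < N₀ := by exact_mod_cast (show 0 < N₀ by omega)
  have h2P : (0 : ℝ) < 2 ^ P := by positivity
  have h1 : (a : ℝ) ≤ 2 ^ P * A := aSpec_le v J P hJ1 hv3 j N₀
  have ha0' : (0 : ℝ) ≤ a := by exact_mod_cast ha0
  have h2 : (2 ^ P : ℝ) * 2 ^ P * D ≤ d := by
    have := dSpec_ge v N₀ J P hJ1 hv3 j N₀
    rwa [show min N₀ (N₀ - 1) = N₀ - 1 by omega] at this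
  have h3 : (ρ : ℝ) ≤ 2 ^ P * qu := by
    have hρ := (rootEnc_spec P (show 1 ≤ N₀ by omega) (show 1 ≤ 2 * J by omega)).1
    refine hρ.trans (mul_le_mul_of_nonneg_left ?_ h2P.le)
    rw [hqu]
    exact Real.rpow_le_rpow_of_exponent_le (by exact_mod_cast (show 1 ≤ N₀ by omega)) (neg_le_neg huh)
  have hqu0 : 0 ≤ qu := (Real.rpow_pos_of_pos hq0 _).le
  have h4 : (2 * J * (2 ^ P * 2 ^ P) * Bn + 2 * (N₀ + 1) * r * d : ℝ) <
      2 * (2 * J) * (N₀ + 1) * r * a * ρ := by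
    have hcast : ((a.toNat : ℕ) : ℤ) = a := Int.toNat_of_nonneg ha0
    have hcastR : ((a.toNat : ℕ) : ℝ) = (a : ℝ) := by exact_mod_cast hcast
    have := hineq
    rw [← hcastR]
    exact_mod_cast this
  have h5 : (a : ℝ) * ρ ≤ 2 ^ P * A * (2 ^ P * qu) :=
    mul_le_mul h1 h3 (Nat.cast_nonneg _) (le_trans ha0' h1)
  have hcell := LTruncation.cell_bound (fun n ↦ (v (n + 1) : ℝ)) N₀ s₀ hu0 huh
  have hP : ∑ n ∈ range N₀, (χ ((n + 1 : ℕ) : ZMod q)).re * ((n + 1 : ℕ) : ℝ) ^ (-σ) =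
      ∑ n ∈ range N₀, (v (n + 1) : ℝ) * ((n + 1 : ℕ) : ℝ) ^ (-(s₀ + u)) := by
    refine Finset.sum_congr rfl fun n _ ↦ ?_
    rw [hv, hσ]
  rw [hP]
  refine lt_of_lt_of_le ?_ hcell
  have hr0 : (0 : ℝ) < r := by exact_mod_cast hr
  have hJ0 : (0 : ℝ) < J := by exact_mod_cast hJ1
  set Kc : ℝ := 2 * (2 * J) * (N₀ + 1) * r with hKc
  have hK0 : 0 < Kc := by rw [hKc]; positivity
  have hmain : (Bn : ℝ) * (2 * J) + D * (2 * (N₀ + 1) * r) < A * qu * Kc := by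
    have h6 : (2 * (2 * J) * (N₀ + 1) * r : ℝ) * (a * ρ) ≤
        (2 * (2 * J) * (N₀ + 1) * r) * (2 ^ P * A * (2 ^ P * qu)) :=
      mul_le_mul_of_nonneg_left h5 (by positivity)
    have h7 : (2 * (N₀ + 1) * r : ℝ) * (2 ^ P * 2 ^ P * D) ≤ (2 * (N₀ + 1) * r) * d :=
      mul_le_mul_of_nonneg_left h2 (by positivity)
    have h8 : (2 : ℝ) ^ P * 2 ^ P * ((Bn : ℝ) * (2 * J) + D * (2 * (N₀ + 1) * r)) <
        2 ^ P * 2 ^ P * (A * qu * Kc) := by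
      rw [hKc]; linarith
    exact lt_of_mul_lt_mul_left h8 (by positivity)
  have e1 : (Bn : ℝ) / (2 * r * (N₀ + 1 : ℕ)) = (Bn : ℝ) * (2 * J) / Kc := by
    rw [hKc]; push_cast; field_simp
  have e2 : 1 / ((2 * J : ℕ) : ℝ) * D = D * (2 * (N₀ + 1) * r) / Kc := by
    rw [hKc]; push_cast; field_simp
  rw [e1, e2, lt_sub_iff_add_lt, ← add_div, div_lt_iff₀ hK0]
  linarith

end Soundness

/-! ## Per-conductor wrappers, ODD characters (parity test or drift certificate) -/

section Wrappers

/-- **Odd characters of odd conductor `q`**: either `((q−1)/q) = +1` (the character is even — excluded) or the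
drift certificate for `(·/q)` passes. [cite: Chua2005RealZeros, §2.2 ALGO 1] -/
theorem good_odd_of_odd {q : ℕ} [NeZero q] (hq2 : q % 2 = 1) (hq1 : 1 < q) (K J P : ℕ)
    (h : valOdd q (q - 1) = 1 ∨ certDriftOK (valOdd q) q K J P = true) :
    ∀ χ : DirichletCharacter ℂ q, χ.IsQuadratic → χ.IsPrimitive → χ.Odd →
      ∀ σ : ℝ, 0 < σ → σ < 1 → χ.LFunction σ ≠ 0 := by
  intro χ hquad hprim hodd σ hσ0 hσ1
  have hv := re_apply_eq_valOdd (Nat.odd_iff.mpr hq2) hq1 hprim hquad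
  rcases h with hpar | hcert
  · exact (OddSmallModuliII.not_odd_of_val _ hv hpar hodd).elim
  · exact lfunction_ne_zero_of_certDriftOK hprim hquad hv hcert σ hσ0 hσ1

/-- **Odd characters of conductor `4m`**, keyed on `q = 4m`. [cite: Chua2005RealZeros, §2.2 ALGO 1] -/
theorem good_odd_of_four {q : ℕ} [NeZero q] (hq8 : q % 8 = 4) (hq1 : 4 < q) (K J P : ℕ)
    (h : valFour (q / 4) (q - 1) = 1 ∨ certDriftOK (valFour (q / 4)) q K J P = true) :
    ∀ χ : DirichletCharacter ℂ q, χ.IsQuadratic → χ.IsPrimitive → χ.Odd →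
      ∀ σ : ℝ, 0 < σ → σ < 1 → χ.LFunction σ ≠ 0 := by
  obtain ⟨m, rfl⟩ : ∃ m, q = 4 * m := ⟨q / 4, by omega⟩
  haveI : NeZero m := ⟨by omega⟩
  rw [Nat.mul_div_cancel_left m (by norm_num : 0 < 4)] at h
  intro χ hquad hprim hodd σ hσ0 hσ1
  have hv := re_apply_eq_valFour (m := m) (Nat.odd_iff.mpr (by omega)) (by omega) hprim hquad
  rcases h with hpar | hcert
  · exact (OddSmallModuliII.not_odd_of_val _ hv hpar hodd).elim
  · exact lfunction_ne_zero_of_certDriftOK hprim hquad hv hcert σ hσ0 hσ1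

/-- **Odd characters of conductor `8m`**, keyed on `q = 8m`: both value patterns.
[cite: Chua2005RealZeros, §2.2 ALGO 1] -/
theorem good_odd_of_eight {q : ℕ} [NeZero q] (hq16 : q % 16 = 8) (hq1 : 8 < q) (K J P : ℕ)
    (hA : valEightA (q / 8) (q - 1) = 1 ∨ certDriftOK (valEightA (q / 8)) q K J P = true)
    (hB : valEightB (q / 8) (q - 1) = 1 ∨ certDriftOK (valEightB (q / 8)) q K J P = true) :
    ∀ χ : DirichletCharacter ℂ q, χ.IsQuadratic → χ.IsPrimitive → χ.Odd →
      ∀ σ : ℝ, 0 < σ → σ < 1 → χ.LFunction σ ≠ 0 := by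
  obtain ⟨m, rfl⟩ : ∃ m, q = 8 * m := ⟨q / 8, by omega⟩
  haveI : NeZero m := ⟨by omega⟩
  rw [Nat.mul_div_cancel_left m (by norm_num : 0 < 8)] at hA hB
  intro χ hquad hprim hodd σ hσ0 hσ1
  rcases re_apply_eq_valEight (m := m) (Nat.odd_iff.mpr (by omega)) (by omega) hprim hquad with hv | hv
  · rcases hA with hpar | hcert
    · exact (OddSmallModuliII.not_odd_of_val _ hv hpar hodd).elim
    · exact lfunction_ne_zero_of_certDriftOK hprim hquad hv hcert σ hσ0 hσ1
  · rcases hB with hpar | hcert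
    · exact (OddSmallModuliII.not_odd_of_val _ hv hpar hodd).elim
    · exact lfunction_ne_zero_of_certDriftOK hprim hquad hv hcert σ hσ0 hσ1

end Wrappers

end LTruncationCert

end Literature.NumberTheory.LFunctions
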